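import Summits.AtomisticToContinuum.HydrodynamicLimit.Theorems.ImplosionDichotomyDiluteSelfConsistencyBoundedFamilies

/-!
# The bounded-family principle on a finite horizon (uniform initial layer) — `DiluteSelfConsistency`, Case I (stmt-3091)

Support lemma for the crux `ImplosionDichotomy.DiluteSelfConsistency` (stmt-AtomisticToContinuum-3091), line `birth`
(rev c2), Case I (`stub_boundedIdealDiluteSmooth`). The horizon-restricted form of
`DiluteSelfConsistencyBoundedFamilies.pde_of_boundedGlobalFamily`: if for every small `σ` the pinned data
`(rhoLim (profileOf a₀) σ, u₀, θ₀)` launch SOME classical hard-sphere-Euler solution on the FIXED horizon `[0, t₀)` with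
density `≤ B` (`t₀`, `B` independent of `σ`), then for every level `η > 0`, below an explicit threshold, EVERY classical
solution on any `[0, T)` with the pinned data has packing `< η` on the initial layer `[0, min T t₀)` — the reference solution
restricted to `[0, min T t₀)` is dilute, uniqueness in the whole typed class (`unique_of_dilute_eos`), `Bσ³ < η`.

This is the plug by which a σ-UNIFORM short-time a-priori theory for the hard-sphere family (the hard-sphere analogue,
uniform in `σ`, of `CompressibleEuler.exists_uniform_time_bounds_general`; layer 4 of the named fact
`hsEuler_continuousDependence`) would give "no implosion in a uniform initial layer" for all smooth profiles:
`diluteSelfConsistencyPDE_upto_of_boundedFamily` (registered sub-goal).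

prover-line-stmt-AtomisticToContinuum-3091-c2-0 (line `birth`, rev c2).
-/

noncomputable section

namespace Summit.AtomisticToContinuum.HydrodynamicLimit.Theorems

open MeasureTheory Filter Set Topology
open Literature.MathematicalPhysics.KineticTheory Literature.Analysis.FluidPDE
open Literature.Analysis.FunctionSpaces

open PolynomialCompressionConstantProfiles (unique_of_dilute_eos)

/-- **THE BOUNDED-FAMILY PRINCIPLE ON A FINITE HORIZON.** Let `a₀` be continuous and positive and suppose that for every
`0 < σ < σ₁` the pinned data `(rhoLim (profileOf a₀) σ, u₀, θ₀)` launch a classical hard-sphere-Euler solution on the fixed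
horizon `[0, t₀)` with density `≤ B`. Then for every `η > 0` there is `σ₀ > 0` such that for `0 < σ < σ₀` EVERY classical
solution on any `[0, T)` with the pinned data has packing `ρ_t(x)σ³ < η` for `t ∈ [0, min T t₀)` (both solutions restricted
to `[0, min T t₀)`; the reference is dilute there; uniqueness in the whole typed class; `Bσ³ < η`). [folklore] -/
theorem diluteSelfConsistencyPDE_upto_of_boundedFamily :
    ∀ (a₀ θ₀ : T3 → ℝ) (u₀ : T3 → V3) (ha : Continuous a₀) (ha0 : ∀ x, 0 < a₀ x) (σ₁ t₀ B : ℝ), 0 < σ₁ →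
      (∀ σ : ℝ, 0 < σ → σ < σ₁ → ∃ (ρ₁ θ₁ : ℝ → T3 → ℝ) (u₁ : ℝ → T3 → V3),
        IsHardSphereEulerSolution σ t₀ ρ₁ u₁ θ₁ ∧ ρ₁ 0 = rhoLim (profileOf a₀ ha ha0) σ ∧ u₁ 0 = u₀ ∧ θ₁ 0 = θ₀ ∧
          ∀ t ∈ Ico 0 t₀, ∀ x, ρ₁ t x ≤ B) →
      ∀ η : ℝ, 0 < η → ∃ σ₀ : ℝ, 0 < σ₀ ∧ ∀ σ : ℝ, 0 < σ → σ < σ₀ →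
        ∀ (T : ℝ) (ρ θ : ℝ → T3 → ℝ) (u : ℝ → T3 → V3), IsHardSphereEulerSolution σ T ρ u θ →
          ρ 0 = rhoLim (profileOf a₀ ha ha0) σ → u 0 = u₀ → θ 0 = θ₀ →
            ∀ t ∈ Ico 0 (min T t₀), ∀ x, ρ t x * σ ^ 3 < η := by
  intro a₀ θ₀ u₀ ha ha0 σ₁ t₀ B hσ₁ hfam η hη
  obtain ⟨η₁, hη₁, U⟩ := unique_of_dilute_eos
  set B' : ℝ := max B 1 with hB'
  have hB'1 : 1 ≤ B' := le_max_right _ _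
  have hB'0 : 0 < B' := one_pos.trans_le hB'1
  have hBB' : B ≤ B' := le_max_left _ _
  refine ⟨min σ₁ (min 1 (min (η / (2 * B')) (η₁ / (2 * B')))),
    lt_min hσ₁ (lt_min one_pos (lt_min (by positivity) (by positivity))), ?_⟩
  intro σ hσ hσlt T ρ θ u hE h1 h2 h3 t ht x
  have hσ₁' : σ < σ₁ := lt_of_lt_of_le hσlt (min_le_left _ _)
  have hσ1 : σ < 1 := lt_of_lt_of_le hσlt ((min_le_right _ _).trans (min_le_left _ _))
  have hση : σ < η / (2 * B') :=
    lt_of_lt_of_le hσlt ((min_le_right _ _).trans ((min_le_right _ _).trans (min_le_left _ _)))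
  have hση₁ : σ < η₁ / (2 * B') :=
    lt_of_lt_of_le hσlt ((min_le_right _ _).trans ((min_le_right _ _).trans (min_le_right _ _)))
  have hσ3 : σ ^ 3 ≤ σ := pow_le_of_le_one hσ.le hσ1.le three_ne_zero
  have hσ30 : 0 ≤ σ ^ 3 := pow_nonneg hσ.le 3
  rw [lt_div_iff₀ (by positivity)] at hση hση₁
  have hBσ : B' * σ ^ 3 ≤ B' * σ := mul_le_mul_of_nonneg_left hσ3 hB'0.le
  -- both solutions restricted to the common horizon `S = min T t₀`
  obtain ⟨ρ₁, θ₁, u₁, hE₁, h1₁, h2₁, h3₁, hB⟩ := hfam σ hσ hσ₁'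
  set S : ℝ := min T t₀ with hS
  have hES : IsHardSphereEulerSolution σ S ρ u θ := isHardSphereEulerSolution_restrict hE (min_le_left _ _)
  have hE₁S : IsHardSphereEulerSolution σ S ρ₁ u₁ θ₁ := isHardSphereEulerSolution_restrict hE₁ (min_le_right _ _)
  have hpk : ∀ s ∈ Ico 0 S, ∀ y, ρ₁ s y * σ ^ 3 ≤ η₁ / 2 := by
    intro s hs y
    have h := (hB s ⟨hs.1, hs.2.trans_le (min_le_right _ _)⟩ y).trans hBB'
    have : ρ₁ s y * σ ^ 3 ≤ B' * σ ^ 3 := mul_le_mul_of_nonneg_right h hσ30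
    linarith
  obtain ⟨hρt, -, -⟩ := U σ hσ S S ρ₁ θ₁ u₁ ρ θ u hE₁S hES hpk (h1₁.trans h1.symm) (h2₁.trans h2.symm)
    (h3₁.trans h3.symm) t (by rwa [min_self])
  have hx : ρ t x ≤ B' :=
    (le_of_eq (congrFun hρt x)).trans ((hB t ⟨ht.1, ht.2.trans_le (min_le_right _ _)⟩ x).trans hBB')
  have : ρ t x * σ ^ 3 ≤ B' * σ ^ 3 := mul_le_mul_of_nonneg_right hx hσ30
  linarith

end Summit.AtomisticToContinuum.HydrodynamicLimit.Theorems

end
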